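import Summits.QuantumAdvantage.QuantumAdvantage.Theorems.HankelLiftBeyondRectanglesDefs
import Literature.Computability.Complexity.CodeFPStringKit
import Literature.Computability.Complexity.CodeFPBudgets
import HarnessLib

/-!
# Route HankelLift, crux `BeyondRectangles` (stmt-QuantumAdvantage-18440): the antidiagonal sampler

Objects and machine-side facts for the registered stub `stub_antidiagonalSampling` of the line `birth`
(`Cruxes/BeyondRectangles/Lines/birth.lean`, sha `f6a15a6c0aead5bb`): "the sum-lift `m = x + y` is
transparent to PPT — every PPT pair-predictor `A` yields a PPT sum-predictor `B` whose SUM correlation with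
`λ(m+2)` under the triangular law tracks `A`'s PAIR correlation".  Here (over the objects of
`HankelLiftBeyondRectanglesDefs.lean`, p555913):

* the antidiagonal `{(x, y) ∈ [2ⁿ]² : x + y = m}` parametrised as `x = lo + j`, `j < R`, with
  `lo = m ∸ (2ⁿ − 1)`, `R = min(m, 2ⁿ−1) + 1 ∸ lo` (`adLo`, `adLen`, `adPt`, `fiber`; `sum_fiber_eq`,
  `antidiag_eq_adLen : rₙ(m) = R`, `adLen_le : R ≤ 2ⁿ`, `sum_antidiag : Σ_m rₙ(m) = 4ⁿ`);
* the SAMPLER `B = sampler A` (a `RandAlg`): on input `w` (`= encSum n m`, so `n = |w| − 1`, `m = val w`)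
  with coins `c = u ++ r`, `|u| = T = |w| + 6`, it runs `A` on `enc n x (m − x)` for `x = lo + (val(u) mod R)`
  with the remaining coins `r`; coin budget `T + coinLen_A(3n + 2)` (no loop, no failure branch: reduction
  mod `R` of a uniform `T`-bit number is `R/2^T ≤ 2⁻⁷`-close to uniform on `[0, R)`);
* `sampler_isPolyTime`: `B` is PPT whenever `A` is — its run map is `A`'s composed
  (`PolyTimeComputable.comp_holds`) with the pre-processor `(w, c) ↦ (enc n x (m − x), c ⇂ T)`, assembled in
  the typed `CodeFP` algebra (`strVal`, `natPow`, `natSub`, `natMin`, `natMod`, `takeD`, `strTake`,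
  `strDrop`, …; fixed-width bit blocks `bitsₙ x = (bin x).takeD n 0`, `takeD_natE`), and its coin budget is
  bounded by `X + 6 + p_A ∘ (3X + 2)`.

The probability estimate and the stub itself are in `HankelLiftBeyondRectanglesAntidiagonalSampling.lean`.
WHAT THIS IS NOT: nothing here touches the open stub `LiouvilleBPPDark`; no separation is claimed.
-/

-- the sub-problem namespace `Summit.QuantumAdvantage.QuantumAdvantage` repeats the summit name by design (D-0017)
set_option linter.dupNamespace false

noncomputable section

namespace Summit.QuantumAdvantage.QuantumAdvantage.Theorems.BeyondRectangles

open scoped BigOperators Classical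
open Literature.Computability.Complexity Literature.Computability.Complexity.CodeFP
open _root_.Computability (encodeBool encodeNat)

/-! ### The antidiagonal, parametrised -/

/-- The least first summand on the antidiagonal: `lo = m ∸ (2ⁿ − 1)`. [folklore] -/
def adLo (n m : ℕ) : ℕ := m - (2 ^ n - 1)

/-- The length of the antidiagonal: `min(m, 2ⁿ − 1) + 1 ∸ lo`. [folklore] -/
def adLen (n m : ℕ) : ℕ := min m (2 ^ n - 1) + 1 - adLo n m


/-- The antidiagonal fiber `{(x, y) ∈ [2ⁿ]² : x + y = m}`. [folklore] -/
def fiber (n m : ℕ) : Finset (Fin (2 ^ n) × Fin (2 ^ n)) :=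
  (Finset.univ : Finset (Fin (2 ^ n) × Fin (2 ^ n))).filter fun p => p.1.val + p.2.val = m

/-- The `j`-th point of the antidiagonal, `(lo + j, m − lo − j)` (reduced mod `2ⁿ` to be total). [folklore] -/
def adPt (n m j : ℕ) : Fin (2 ^ n) × Fin (2 ^ n) :=
  (⟨(adLo n m + j) % 2 ^ n, Nat.mod_lt _ (Nat.two_pow_pos n)⟩,
    ⟨(m - (adLo n m + j)) % 2 ^ n, Nat.mod_lt _ (Nat.two_pow_pos n)⟩)

/-- `rₙ(m) = #fiber`. [folklore] -/
theorem antidiag_eq_card_fiber (n m : ℕ) : antidiag n m = (fiber n m).card := rfl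

/-- Membership in the fiber. [folklore] -/
theorem mem_fiber {n m : ℕ} {p : Fin (2 ^ n) × Fin (2 ^ n)} : p ∈ fiber n m ↔ p.1.val + p.2.val = m := by
  simp [fiber]

/-- For `j < adLen n m` the point `adPt n m j` needs no reduction. [folklore] -/
theorem adPt_val {n m j : ℕ} (hj : j < adLen n m) :
    (adPt n m j).1.val = adLo n m + j ∧ (adPt n m j).2.val = m - (adLo n m + j) := by
  have hP := Nat.two_pow_pos n
  unfold adLen at hj
  unfold adPt
  have h1 : adLo n m + j < 2 ^ n := by unfold adLo at hj ⊢; omega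
  have h2 : m - (adLo n m + j) < 2 ^ n := by unfold adLo at hj h1 ⊢; omega
  exact ⟨Nat.mod_eq_of_lt h1, Nat.mod_eq_of_lt h2⟩

/-- `adPt` maps `[0, R)` into the fiber. [folklore] -/
theorem adPt_mapsTo (n m : ℕ) : ∀ j ∈ Finset.range (adLen n m), adPt n m j ∈ fiber n m := by
  intro j hj
  rw [Finset.mem_range] at hj
  obtain ⟨h1, h2⟩ := adPt_val hj
  rw [mem_fiber, h1, h2]
  unfold adLen adLo at *
  have hP := Nat.two_pow_pos n
  omega

/-- `adPt` is injective on `[0, R)`. [folklore] -/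
theorem adPt_injOn (n m : ℕ) : Set.InjOn (adPt n m) (Finset.range (adLen n m) : Set ℕ) := by
  intro j hj j' hj' h
  rw [Finset.coe_range, Set.mem_Iio] at hj hj'
  have h1 := (adPt_val hj).1
  have h1' := (adPt_val hj').1
  have h1v : (adPt n m j).1.val = (adPt n m j').1.val := by rw [h]
  omega

/-- `adPt` maps `[0, R)` onto the fiber. [folklore] -/
theorem adPt_surjOn (n m : ℕ) :
    Set.SurjOn (adPt n m) (Finset.range (adLen n m) : Set ℕ) (fiber n m : Set (Fin (2 ^ n) × Fin (2 ^ n))) := by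
  intro p hp
  rw [Finset.mem_coe, mem_fiber] at hp
  have hx := p.1.isLt
  have hy := p.2.isLt
  have hP := Nat.two_pow_pos n
  refine ⟨p.1.val - adLo n m, ?_, ?_⟩
  · rw [Finset.coe_range, Set.mem_Iio]
    unfold adLen adLo
    omega
  · have hj : p.1.val - adLo n m < adLen n m := by unfold adLen adLo; omega
    obtain ⟨h1, h2⟩ := adPt_val hj
    have e1 : adLo n m + (p.1.val - adLo n m) = p.1.val := by unfold adLo; omega
    refine Prod.ext (Fin.ext ?_) (Fin.ext ?_)
    · rw [h1, e1]
    · rw [h2, e1]; omega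

/-- **Parametrising the antidiagonal**: sums over the fiber are sums over `j < adLen n m`. [folklore] -/
theorem sum_fiber_eq (n m : ℕ) (g : Fin (2 ^ n) × Fin (2 ^ n) → ℝ) :
    ∑ p ∈ fiber n m, g p = ∑ j ∈ Finset.range (adLen n m), g (adPt n m j) :=
  (Finset.sum_nbij (adPt n m) (adPt_mapsTo n m) (adPt_injOn n m) (adPt_surjOn n m) fun _ _ => rfl).symm

/-- `rₙ(m) = adLen n m`. [folklore] -/
theorem antidiag_eq_adLen (n m : ℕ) : antidiag n m = adLen n m := by
  rw [antidiag_eq_card_fiber, ← Finset.card_nbij (adPt n m) (adPt_mapsTo n m) (adPt_injOn n m) (adPt_surjOn n m),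
    Finset.card_range]

/-- `rₙ(m) ≤ 2ⁿ`. [folklore] -/
theorem adLen_le (n m : ℕ) : adLen n m ≤ 2 ^ n := by
  unfold adLen adLo; have := Nat.two_pow_pos n; omega

/-- `Σ_{m < 2ⁿ⁺¹} rₙ(m) = 4ⁿ`. [folklore] -/
theorem sum_antidiag (n : ℕ) : ∑ m ∈ Finset.range (2 ^ (n + 1)), (antidiag n m : ℝ) = (4 : ℝ) ^ n := by
  have hmaps : Set.MapsTo (fun p : Fin (2 ^ n) × Fin (2 ^ n) => p.1.val + p.2.val)
      ((Finset.univ : Finset (Fin (2 ^ n) × Fin (2 ^ n))) : Set _) (Finset.range (2 ^ (n + 1)) : Set ℕ) := by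
    intro p _
    simp only [Finset.coe_range, Set.mem_Iio]
    rw [pow_succ]
    have := p.1.isLt; have := p.2.isLt; omega
  have h := Finset.card_eq_sum_card_fiberwise hmaps
  rw [Finset.card_univ, Fintype.card_prod, Fintype.card_fin] at h
  have h4 : (4 : ℝ) ^ n = ((2 ^ n * 2 ^ n : ℕ) : ℝ) := by push_cast; rw [← mul_pow]; norm_num
  rw [h4, h]
  push_cast
  rfl

/-! ### The sampler -/

/-- Number of sampling coins on input `w` (`w = encSum n m` has length `n + 1`): `T = |w| + 6 = n + 7`. [folklore] -/
def sampT (w : List Bool) : ℕ := w.length + 6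

/-- The sampled first summand: `x = lo + (val(u) mod R)` from the coin block `u`, at level `n = |w| − 1` and
sum `m = val(w)`. [folklore] -/
def sampX (w u : List Bool) : ℕ :=
  adLo (w.length - 1) (bitsToNat w) + bitsToNat u % adLen (w.length - 1) (bitsToNat w)

/-- The query to the pair predictor: `enc n x (m − x)`. [folklore] -/
def sampQuery (w u : List Bool) : List Bool :=
  enc (w.length - 1) (sampX w u) (bitsToNat w - sampX w u)

/-- **The antidiagonal sampler** `B = sampler A`: on input `w` with coins `c = u ++ r` (`|u| = T`), run `A` on
`enc n x (m − x)` for `x = lo + (val(u) mod R)` with the remaining coins `r`; coin budget `T + coinLen_A(3n + 2)`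
(`|enc n x y| = 3n + 2`). [cite: AroraBarak2009, §7.1] -/
def sampler (A : RandAlg (List Bool) Bool) : RandAlg (List Bool) Bool where
  run w c := A.run (sampQuery w (c.take (sampT w))) (c.drop (sampT w))
  coinLen L := (L + 6) + A.coinLen (3 * (L - 1) + 2)

/-- `|enc n x y| = 3n + 2`. [folklore] -/
theorem length_enc (n x y : ℕ) : (enc n x y).length = 3 * n + 2 := by
  simp only [enc, length_boolPair, List.length_ofFn]; ring

/-- `|sampQuery w u| = 3(|w| − 1) + 2`. [folklore] -/
theorem length_sampQuery (w u : List Bool) : (sampQuery w u).length = 3 * (w.length - 1) + 2 := by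
  unfold sampQuery; exact length_enc _ _ _

/-! ### The sampler is probabilistic polynomial time -/

/-- Fixed-width little-endian bit blocks from binary numerals: `(bin x).takeD n 0 = bitsₙ x` for `x < 2ⁿ`... in fact
for all `x` the first `n` bits agree; we only need and prove the general form via `getD`. [folklore] -/
theorem takeD_natE (n x : ℕ) : (natE x).takeD n false = List.ofFn fun i : Fin n => Nat.testBit x i := by
  rw [BitFormat.takeD_eq_take_append_replicate]
  apply List.ext_getElem
  · simp
  · intro i h1 h2
    rw [List.length_ofFn] at h2
    rw [List.getElem_take, List.getElem_ofFn, testBit_eq_getD_natE]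
    by_cases h : i < (natE x).length
    · rw [List.getElem_append_left h, List.getD_eq_getElem _ _ h]
    · push Not at h
      rw [List.getElem_append_right h, List.getElem_replicate, List.getD_eq_default _ _ h]
where
  /-- bits of a numeral -/
  testBit_eq_getD_natE : ∀ (x i : ℕ), Nat.testBit x i = (natE x).getD i false := fun x i => by
    have h := testBit_bitsToNat_eq_getD (natE x) i
    rwa [bitsToNat_natE] at h

/-- Unary predecessor. [folklore] -/
theorem unPred : CodeFP unE unE (fun k => k - 1) :=
  (unOfNatMin.comp ((CodeFP.id unE).pair (natSub.comp (natOfUn.pair (const unE (1 : ℕ)))))).congr fun k => by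
    simp only [id]
    exact min_eq_left (Nat.sub_le _ _)

/-- `(1ⁿ, x) ↦ bitsₙ x`. [folklore] -/
theorem codeFP_bits : CodeFP (pairE unE natE) strE (fun p => List.ofFn fun i : Fin p.1 => Nat.testBit p.2 i) :=
  (takeD.comp ((fst unE natE).pair (strOfNat.comp (snd unE natE)))).congr fun p => takeD_natE p.1 p.2

/-- `(1ⁿ, x, y) ↦ enc n x y`. [folklore] -/
theorem codeFP_enc : CodeFP (pairE unE (pairE natE natE)) strE (fun p => enc p.1 p.2.1 p.2.2) :=
  ((codeFP_bits.comp ((fst _ _).pair (snd _ _).fst')).pair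
    (codeFP_bits.comp ((fst _ _).pair (snd _ _).snd'))).recodeOut fun _ => rfl

/-- `w ↦ 1^{|w| − 1}` (the level `n`). [folklore] -/
theorem codeFP_level : CodeFP strE unE (fun w => w.length - 1) := unPred.comp strLength

/-- `w ↦ 2ⁿ`, `n = |w| − 1`. [folklore] -/
theorem codeFP_twoPow : CodeFP strE natE (fun w => 2 ^ (w.length - 1)) :=
  natPow.comp ((const strE (2 : ℕ)).pair codeFP_level)

/-- `w ↦ lo = val(w) ∸ (2ⁿ − 1)`. [folklore] -/
theorem codeFP_adLo : CodeFP strE natE (fun w => adLo (w.length - 1) (bitsToNat w)) :=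
  (natSub.comp (strVal.pair (natSub.comp (codeFP_twoPow.pair (const strE (1 : ℕ)))))).congr fun _ => rfl

/-- `w ↦ R = min(val(w), 2ⁿ − 1) + 1 ∸ lo`. [folklore] -/
theorem codeFP_adLen : CodeFP strE natE (fun w => adLen (w.length - 1) (bitsToNat w)) :=
  (natSub.comp ((natAdd.comp ((natMin.comp (strVal.pair (natSub.comp (codeFP_twoPow.pair (const strE (1 : ℕ)))))).pair
    (const strE (1 : ℕ)))).pair codeFP_adLo)).congr fun _ => rfl

/-- `(w, u) ↦ x = lo + (val(u) mod R)`. [folklore] -/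
theorem codeFP_sampX : CodeFP (pairE strE strE) natE (fun q => sampX q.1 q.2) :=
  (natAdd.comp ((codeFP_adLo.comp (fst _ _)).pair
    (natMod.comp ((strVal.comp (snd _ _)).pair (codeFP_adLen.comp (fst _ _)))))).congr fun _ => rfl

/-- `(w, u) ↦ enc n x (m − x)`. [folklore] -/
theorem codeFP_sampQuery : CodeFP (pairE strE strE) strE (fun q => sampQuery q.1 q.2) :=
  (codeFP_enc.comp ((codeFP_level.comp (fst _ _)).pair
    (codeFP_sampX.pair (natSub.comp ((strVal.comp (fst _ _)).pair codeFP_sampX))))).congr fun _ => rfl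

/-- `w ↦ 1^T`. [folklore] -/
theorem codeFP_sampT : CodeFP strE unE sampT :=
  (unAdd.comp (strLength.pair (const strE (6 : ℕ)))).congr fun _ => rfl

/-- **The pre-processor of the sampler**: `(w, c) ↦ (enc n x (m − x), c ⇂ T)` with `x` read off `c ↾ T`.
[cite: AroraBarak2009, §7.1] -/
theorem codeFP_samplerPre : CodeFP (pairE strE strE) (pairE strE strE)
    (fun q => (sampQuery q.1 (q.2.take (sampT q.1)), q.2.drop (sampT q.1))) :=
  (codeFP_sampQuery.comp ((fst _ _).pair (strTake.comp ((codeFP_sampT.comp (fst _ _)).pair (snd _ _))))).pair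
    (strDrop.comp ((codeFP_sampT.comp (fst _ _)).pair (snd _ _)))

/-- **The sampler is PPT** whenever `A` is: its run map is `A`'s composed with a polynomial-time pre-processor
(`PolyTimeComputable.comp_holds`), and its coin budget is `L + 6 + coinLen_A(3(L−1)+2) ≤ L + 6 + p_A(3L + 2)`.
[cite: AroraBarak2009, §7.1] -/
theorem sampler_isPolyTime {A : RandAlg (List Bool) Bool} (hA : A.IsPolyTime id encodeBool) :
    (sampler A).IsPolyTime id encodeBool := by
  refine ⟨?_, ?_⟩
  · exact PolyTimeComputable.comp_holds hA.1 codeFP_samplerPre.polyTimeComputable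
  · obtain ⟨p, hp⟩ := hA.2
    refine ⟨Polynomial.X + 6 + p.comp (3 * Polynomial.X + 2), fun L => ?_⟩
    have h1 := hp (3 * (L - 1) + 2)
    have h2 : p.eval (3 * (L - 1) + 2) ≤ p.eval (3 * L + 2) := TM2Iter.eval_mono p (by omega)
    simp only [sampler, Polynomial.eval_add, Polynomial.eval_X, Polynomial.eval_comp, Polynomial.eval_mul,
      Polynomial.eval_ofNat]
    omega


end Summit.QuantumAdvantage.QuantumAdvantage.Theorems.BeyondRectangles

end
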